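import Literature.MathematicalPhysics.QuantumFieldTheory.Balaban1983to89.B15Prop1ModelCarrier

/-!
# `Balaban1983to89.B15Prop1KernelSchur` — T. Bałaban, *Large field renormalization. II*, Commun. Math. Phys. **122** (1989)
355–392 [Balaban1989LargeFieldII] p. 359 (the constant `B₃` in *«2γ₀⁻¹2d(100M)⁵B₃²4ε_k»*) with [Balaban1985Variational] (190)
p. 308: the OPERATOR-NORM LETTER (m2) of the Proposition-1 model (`‖H*_{1,k}‖ ≤ hst`, `‖H_{1,k}‖ ≤ h₁` in
`B15Prop1FromModel.prop1Printed_of_model` ∕ `B15Prop1ModelCarrier.prop1Printed_lfVarOfModel` ∕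
`B15Prop1CarrierOnFromModel.prop1Printed_lfVarOn_of_model`) REDUCED, on `ℓ²` lattice carriers, to print's kernel input — the
exponential decay (190) of the kernel of `H_{1,k}` summed by the row-sum lemma (2.61) of [Balaban1984PropagatorsII]: a
SCHUR TEST for real kernels between Euclidean spaces, PROVED, and the (m2) supplier from row ∕ column sums.

statement-level skeleton of published theorems with citation tags; proofs where landed; nothing here is a claim about
the Yang–Mills mass gap

Cell pub-ymgap, HUMAN RULING D-0062 (Track A full width), seat `pub-ymgap-dag-n12-c` (R134 acceleration seat (a), strategy s1 of
DAG node N12 = [B15]; seventh product).  n01-b ∕ n12-b located (pub-ymgap INBOX l.9173, 2026-08-25): *«the ONLY printed clause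
whose located inputs are still LETTERS = the size of the RHS of (1.13): (m2) ‖H*_{1,k}‖ ≤ B₃ (from (190) [15]) and (m4)»* — this
file types the (190) ⇒ (m2) step.  PDFs held: `paper:balaban1989-cmp122-large-field-ii` (p. 359 = PDF 5),
`paper:balaban1985-cmp102-variational-background` (journal page = PDF page + 276; p. 308 = PDF 32).

THE PRINT.  [LF-II] p. 359: *«it can be bounded by 2γ₀⁻¹2d(100M)⁵B₃²4ε_k»* (`B₃` = the uniform bound of the minimizer
kernels, [IV] (1.46)).  [15] (190) p. 308: *«|(δ/δB_ν(y′))𝓗_μ(B,x)|, … ≦ O(1)[(L^jη)⁻¹, …](L^{j′}η)^{−d} exp(−⅛δ₀d(y,y′))»* —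
the kernel of the linearisation `H_{1,k}` of the minimizer decays exponentially; with the summation lemma (2.61) of
[Balaban1984PropagatorsII] (*«Σ_{y′} exp(−δd(y,y′)) ≦ c₁»*-type row sums) every ROW SUM and COLUMN SUM of `|kernel|` is
`≦ B₃`, whence the `ℓ² → ℓ²` bound by Schur's test.

WHAT THIS FILE PROVES (theorems only; Mathlib + `B15Prop1ModelCarrier` (for the vocabulary of the consumers); no `sorry`, no
definition, no `… : Prop` fact; axioms standard).
§1 **`sum_sq_kernel_le`** — SCHUR'S TEST for a real kernel `K : σ → κ → ℝ` between finite index types: if every row sum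
   `Σ_c |K s c| ≤ m` and every column sum `Σ_s |K s c| ≤ m` (`0 ≤ m`), then `Σ_s (Σ_c K s c · z c)² ≤ m² · Σ_c (z c)²`
   (Cauchy–Schwarz in the weighted form `(Σ_c K z)² ≤ (Σ_c|K|)(Σ_c|K|z²)`, then the column sums).
§2 **`norm_kernelOp_le`** — for Euclidean spaces `EuclideanSpace ℝ κ → EuclideanSpace ℝ σ` and ANY map `T` acting by the
   kernel (`(T z) s = Σ_c K s c · z c`), the operator bound `‖T z‖ ≤ m‖z‖` — the letters `hHst : ‖H* z‖ ≤ hst‖z‖` ∕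
   `hH : ‖H x‖ ≤ h₁‖x‖` of the Proposition-1 model SUPPLIED with `hst = h₁ = m = B₃` from the row ∕ column sums of (190)+(2.61).

HONEST SCOPE.  (190) itself, the identification of `H_{1,k}` ∕ `H*_{1,k}` of record with kernel operators on `ℓ²` bond spaces,
and the row-sum lemma (2.61) at Bałaban's geometry are NOT typed here (located letters: the kernel `K` and the bound `m` are
data ∕ hypotheses); the file is the `ℓ²` bookkeeping between them and (m2).  Count-neutral; NOT summit progress.
-/

noncomputable section

open Finset
open scoped BigOperators

namespace Literature.MathematicalPhysics.QuantumFieldTheory.Balaban1983to89.B15Prop1KernelSchur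

/-! ## §1 Schur's test for a real kernel between finite index types -/

section Schur

variable {σ κ : Type*} [Fintype σ] [Fintype κ]

/-- Weighted Cauchy–Schwarz for one row: `(Σ_c K_c z_c)² ≤ (Σ_c |K_c|)·(Σ_c |K_c| z_c²)` (private plumbing). [folklore] -/
private theorem sq_sum_mul_le (K z : κ → ℝ) :
    (∑ c, K c * z c) ^ 2 ≤ (∑ c, |K c|) * ∑ c, |K c| * z c ^ 2 := by
  -- `Σ K z = Σ (√|K|·sgn K)·(√|K|·z)`; Cauchy–Schwarz with the weights `|K c|`
  have hl : ∑ c, (Real.sqrt |K c| * (if 0 ≤ K c then (1 : ℝ) else -1)) * (Real.sqrt |K c| * z c) = ∑ c, K c * z c := by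
    refine Finset.sum_congr rfl fun c _ => ?_
    have hs : Real.sqrt |K c| * Real.sqrt |K c| = |K c| := Real.mul_self_sqrt (abs_nonneg _)
    by_cases hc : 0 ≤ K c
    · rw [if_pos hc]
      calc Real.sqrt |K c| * 1 * (Real.sqrt |K c| * z c) = (Real.sqrt |K c| * Real.sqrt |K c|) * z c := by ring
        _ = |K c| * z c := by rw [hs]
        _ = K c * z c := by rw [abs_of_nonneg hc]
    · rw [if_neg hc]
      have hc' : K c < 0 := lt_of_not_ge hc
      calc Real.sqrt |K c| * -1 * (Real.sqrt |K c| * z c) = -((Real.sqrt |K c| * Real.sqrt |K c|) * z c) := by ring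
        _ = -(|K c| * z c) := by rw [hs]
        _ = K c * z c := by rw [abs_of_neg hc']; ring
  have h1 : ∑ c, (Real.sqrt |K c| * (if 0 ≤ K c then (1 : ℝ) else -1)) ^ 2 = ∑ c, |K c| := by
    refine Finset.sum_congr rfl fun c _ => ?_
    have hs : Real.sqrt |K c| ^ 2 = |K c| := Real.sq_sqrt (abs_nonneg _)
    by_cases hc : 0 ≤ K c
    · rw [if_pos hc]; rw [mul_one, hs]
    · rw [if_neg hc]; rw [mul_pow, hs]; norm_num
  have h2 : ∑ c, (Real.sqrt |K c| * z c) ^ 2 = ∑ c, |K c| * z c ^ 2 := by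
    refine Finset.sum_congr rfl fun c _ => ?_
    rw [mul_pow, Real.sq_sqrt (abs_nonneg _)]
  have h' : (∑ c, K c * z c) ^ 2 ≤
      (∑ c, (Real.sqrt |K c| * (if 0 ≤ K c then (1 : ℝ) else -1)) ^ 2) * ∑ c, (Real.sqrt |K c| * z c) ^ 2 := by
    rw [← hl]
    exact Finset.sum_mul_sq_le_sq_mul_sq univ _ _
  rw [h1, h2] at h'
  exact h'

/-- **Schur's test** (real kernel, finite index types): if the row sums `Σ_c |K s c| ≤ m` and the column sums `Σ_s |K s c| ≤ m`,
then `Σ_s (Σ_c K s c · z c)² ≤ m²·Σ_c z c²` — the `ℓ² → ℓ²` bound of a kernel operator by the geometric mean of its row and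
column `ℓ¹` sizes (here equal).  With (190) [15] + (2.61) this is *«‖H*_{1,k}‖ ≤ B₃»* (n12-b's (m2)). [cite: Balaban1985Variational,
(190) p.308; Balaban1984PropagatorsII, Lemma 2.1 (2.61) (row sums); Balaban1989LargeFieldII, p.359 («B₃²»)] -/
theorem sum_sq_kernel_le (K : σ → κ → ℝ) (z : κ → ℝ) {m : ℝ} (hm : 0 ≤ m)
    (hrow : ∀ s, ∑ c, |K s c| ≤ m) (hcol : ∀ c, ∑ s, |K s c| ≤ m) :
    ∑ s, (∑ c, K s c * z c) ^ 2 ≤ m ^ 2 * ∑ c, z c ^ 2 := by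
  -- row by row: `(Σ_c K z)² ≤ (Σ_c|K|)·Σ_c|K|z² ≤ m·Σ_c|K s c|z c²`
  have hrow' : ∀ s, (∑ c, K s c * z c) ^ 2 ≤ m * ∑ c, |K s c| * z c ^ 2 := fun s =>
    (sq_sum_mul_le (K s) z).trans
      (mul_le_mul_of_nonneg_right (hrow s) (Finset.sum_nonneg fun c _ => mul_nonneg (abs_nonneg _) (sq_nonneg _)))
  -- then the column sums
  calc ∑ s, (∑ c, K s c * z c) ^ 2 ≤ ∑ s, m * ∑ c, |K s c| * z c ^ 2 := Finset.sum_le_sum fun s _ => hrow' s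
    _ = m * ∑ c, (∑ s, |K s c|) * z c ^ 2 := by
        rw [← Finset.mul_sum, Finset.sum_comm]
        congr 1
        refine Finset.sum_congr rfl fun c _ => ?_
        rw [Finset.sum_mul]
    _ ≤ m * ∑ c, m * z c ^ 2 := by
        refine mul_le_mul_of_nonneg_left (Finset.sum_le_sum fun c _ => ?_) hm
        exact mul_le_mul_of_nonneg_right (hcol c) (sq_nonneg _)
    _ = m ^ 2 * ∑ c, z c ^ 2 := by rw [← Finset.mul_sum]; ring

end Schur

/-! ## §2 The operator letters (m2) of the Proposition-1 model from row ∕ column sums -/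

section Operator

variable {σ κ : Type*} [Fintype σ] [Fintype κ]

/-- **`‖T z‖ ≤ m‖z‖` for a kernel operator between Euclidean spaces** — `T : EuclideanSpace ℝ κ → EuclideanSpace ℝ σ` acting
by the kernel `K` (`(T z) s = Σ_c K s c · z c`; e.g. `H*_{1,k}` or `H_{1,k}` of record in `ℓ²` bond coordinates) with row and
column sums of `|K|` at most `m ≥ 0` satisfies the letter `hHst` ∕ `hH` of `B15Prop1FromModel.prop1Printed_of_model`,
`B15Prop1ModelCarrier.prop1Printed_lfVarOfModel`, `B15Prop1CarrierOnFromModel.prop1Printed_lfVarOn_of_model` with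
`hst = m` (print: `m = B₃` from (190) [15] summed by (2.61)). [cite: Balaban1985Variational, (190) p.308; Balaban1989LargeFieldII,
p.359 («bounded by 2γ₀⁻¹2d(100M)⁵B₃²4ε_k»)] -/
theorem norm_kernelOp_le (K : σ → κ → ℝ) {m : ℝ} (hm : 0 ≤ m) (hrow : ∀ s, ∑ c, |K s c| ≤ m)
    (hcol : ∀ c, ∑ s, |K s c| ≤ m) (T : EuclideanSpace ℝ κ → EuclideanSpace ℝ σ)
    (hT : ∀ (z : EuclideanSpace ℝ κ) (s : σ), (T z).ofLp s = ∑ c, K s c * z.ofLp c) (z : EuclideanSpace ℝ κ) :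
    ‖T z‖ ≤ m * ‖z‖ := by
  have h1 : ‖T z‖ ^ 2 = ∑ s, (∑ c, K s c * z.ofLp c) ^ 2 := by
    rw [EuclideanSpace.norm_sq_eq]
    refine Finset.sum_congr rfl fun s _ => ?_
    rw [Real.norm_eq_abs, sq_abs, hT]
  have h2 : ‖z‖ ^ 2 = ∑ c, z.ofLp c ^ 2 := by
    rw [EuclideanSpace.norm_sq_eq]
    refine Finset.sum_congr rfl fun c _ => ?_
    rw [Real.norm_eq_abs, sq_abs]
  have h3 : ‖T z‖ ^ 2 ≤ (m * ‖z‖) ^ 2 := by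
    rw [h1, mul_pow, h2]
    exact sum_sq_kernel_le K z.ofLp hm hrow hcol
  exact (pow_le_pow_iff_left₀ (norm_nonneg _) (mul_nonneg hm (norm_nonneg _)) two_ne_zero).1 h3

end Operator

end Literature.MathematicalPhysics.QuantumFieldTheory.Balaban1983to89.B15Prop1KernelSchur

end
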